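import Mathlib.Tactic
import HarnessLib

/-!
# Kozma–Nitzan's Question 8 at three relays — the THREE-CHAIN reduction of the C3 corner (abstract, finite)

Support file (`--supports stmt-CriticalPhenomena-4575`, closed crux; independent mathematics on Kozma–Nitzan's Question 8,
arXiv:2401.12397 §5.5 p. 36), prover `prim-ineq-gen-6` (gen 22).  No definitions, no named facts, no sorries; standard axioms.
Memo `run/shared/lean/prim/prim-ineq-gen-6/PROOF-C3-PATHEND-G22.md` §1 (LEMMAS 1–3).
At the corner C3 = (1,1,1) of the κ = 2 one-block coefficient, after folding the root `a` of a pendant path, the coefficient of an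
increasing test function is a signed weight on the three-level chain `{Z < Y < X} × 2^{V(T₁)}`: levels `X` (sets containing the marker
`v` and `a`), `Y` (containing `a`, not `v`) and `Z` (neither), and the MIDDLE level `Y = c · Π₁` is a constant multiple of a nonnegative
weight (`c` = the out-defect).  Positivity on all up-sets of the chain product — i.e. on all chains of up-sets `U_Z ⊆ U_Y ⊆ U_X` — is then
equivalent to positivity of ONE two-level pair: `(X ; Y+Z)` when `Y ≥ 0` (`threeChain_iff_mergeLow_of_nonneg`) and `(X+Y ; Z)` when `Y ≤ 0`
(`threeChain_iff_mergeHigh_of_nonpos`); in general it is equivalent to BOTH merged pairs being good (`threeChain_iff_both`), and a good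
two-level pair has a good one-level sum (`pair_sum_nonneg_of_pair`).  Finally `pair_nonneg_add_transport`: adding `(P ; −P)` with `P ≥ 0`
pointwise to a good pair keeps it good (the `v`-transport used in every decomposition of the memo).
Here `β` is any finite preorder; "good pair `(M¹ ; M⁰)`" means `Σ_{U₁} M¹ + Σ_{U₀} M⁰ ≥ 0` for all up-sets `U₀ ⊆ U₁`.
[cite: KozmaNitzan2024, Question 8 (§5.5 p. 36)]
-/

namespace Summit.CriticalPhenomena.PercolationContinuityZ3.Theorems

namespace PocketCert

open Finset

variable {β : Type*} [Preorder β]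

/-- A good two-level pair `(M¹ ; M⁰)` has a good one-level sum (take `U₀ = U₁`). [cite: KozmaNitzan2024, Question 8 (§5.5 p. 36)] -/
theorem pair_sum_nonneg_of_pair (M1 M0 : β → ℝ)
    (h : ∀ U1 U0 : Finset β, IsUpperSet (U1 : Set β) → IsUpperSet (U0 : Set β) → U0 ⊆ U1 →
      0 ≤ ∑ b ∈ U1, M1 b + ∑ b ∈ U0, M0 b)
    (V : Finset β) (hV : IsUpperSet (V : Set β)) :
    0 ≤ ∑ b ∈ V, (M1 b + M0 b) := by
  rw [Finset.sum_add_distrib]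
  exact h V V hV hV (subset_refl V)

/-- The `v`-transport: adding `(P ; −P)` with `P ≥ 0` pointwise to a good pair keeps it good, because
`Σ_{U₁} P − Σ_{U₀} P ≥ 0` for `U₀ ⊆ U₁`. [cite: KozmaNitzan2024, Question 8 (§5.5 p. 36)] -/
theorem pair_nonneg_add_transport (M1 M0 P : β → ℝ) (hP : ∀ b, 0 ≤ P b)
    (h : ∀ U1 U0 : Finset β, IsUpperSet (U1 : Set β) → IsUpperSet (U0 : Set β) → U0 ⊆ U1 →
      0 ≤ ∑ b ∈ U1, M1 b + ∑ b ∈ U0, M0 b)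
    (U1 U0 : Finset β) (hU1 : IsUpperSet (U1 : Set β)) (hU0 : IsUpperSet (U0 : Set β)) (hsub : U0 ⊆ U1) :
    0 ≤ ∑ b ∈ U1, (M1 b + P b) + ∑ b ∈ U0, (M0 b - P b) := by
  have h0 := h U1 U0 hU1 hU0 hsub
  have hC : ∑ b ∈ U0, P b ≤ ∑ b ∈ U1, P b :=
    Finset.sum_le_sum_of_subset_of_nonneg hsub fun b _ _ => hP b
  rw [Finset.sum_add_distrib, Finset.sum_sub_distrib]
  linarith

/-- **Three-chain lemma, middle level nonnegative.**  If `Y ≥ 0` pointwise then the triple `(X, Y, Z)` is nonnegative on every chain of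
up-sets `U_Z ⊆ U_Y ⊆ U_X` iff the merged pair `(X ; Y + Z)` is nonnegative on every pair of up-sets `U₀ ⊆ U₁`
(the optimal middle up-set is the lowest one). [cite: KozmaNitzan2024, Question 8 (§5.5 p. 36)] -/
theorem threeChain_iff_mergeLow_of_nonneg (X Y Z : β → ℝ) (hY : ∀ b, 0 ≤ Y b) :
    (∀ UX UY UZ : Finset β, IsUpperSet (UX : Set β) → IsUpperSet (UY : Set β) → IsUpperSet (UZ : Set β) →
        UZ ⊆ UY → UY ⊆ UX → 0 ≤ ∑ b ∈ UX, X b + ∑ b ∈ UY, Y b + ∑ b ∈ UZ, Z b) ↔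
      (∀ U1 U0 : Finset β, IsUpperSet (U1 : Set β) → IsUpperSet (U0 : Set β) → U0 ⊆ U1 →
        0 ≤ ∑ b ∈ U1, X b + ∑ b ∈ U0, (Y b + Z b)) := by
  constructor
  · intro h U1 U0 hU1 hU0 hsub
    have := h U1 U0 U0 hU1 hU0 hU0 (subset_refl U0) hsub
    rw [Finset.sum_add_distrib]
    linarith
  · intro h UX UY UZ hX hY' hZ hZY hYX
    have h1 := h UX UZ hX hZ (hZY.trans hYX)
    rw [Finset.sum_add_distrib] at h1
    have hC : ∑ b ∈ UZ, Y b ≤ ∑ b ∈ UY, Y b :=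
      Finset.sum_le_sum_of_subset_of_nonneg hZY fun b _ _ => hY b
    linarith

/-- **Three-chain lemma, middle level nonpositive.**  If `Y ≤ 0` pointwise then the triple `(X, Y, Z)` is nonnegative on every chain of
up-sets `U_Z ⊆ U_Y ⊆ U_X` iff the merged pair `(X + Y ; Z)` is nonnegative on every pair of up-sets `U₀ ⊆ U₁`
(the optimal middle up-set is the highest one). [cite: KozmaNitzan2024, Question 8 (§5.5 p. 36)] -/
theorem threeChain_iff_mergeHigh_of_nonpos (X Y Z : β → ℝ) (hY : ∀ b, Y b ≤ 0) :
    (∀ UX UY UZ : Finset β, IsUpperSet (UX : Set β) → IsUpperSet (UY : Set β) → IsUpperSet (UZ : Set β) →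
        UZ ⊆ UY → UY ⊆ UX → 0 ≤ ∑ b ∈ UX, X b + ∑ b ∈ UY, Y b + ∑ b ∈ UZ, Z b) ↔
      (∀ U1 U0 : Finset β, IsUpperSet (U1 : Set β) → IsUpperSet (U0 : Set β) → U0 ⊆ U1 →
        0 ≤ ∑ b ∈ U1, (X b + Y b) + ∑ b ∈ U0, Z b) := by
  constructor
  · intro h U1 U0 hU1 hU0 hsub
    have := h U1 U1 U0 hU1 hU1 hU0 hsub (subset_refl U1)
    rw [Finset.sum_add_distrib]
    linarith
  · intro h UX UY UZ hX hY' hZ hZY hYX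
    have h1 := h UX UZ hX hZ (hZY.trans hYX)
    rw [Finset.sum_add_distrib] at h1
    have hC : ∑ b ∈ UX, (-Y b) ≥ ∑ b ∈ UY, (-Y b) :=
      Finset.sum_le_sum_of_subset_of_nonneg hYX fun b _ _ => by linarith [hY b]
    rw [Finset.sum_neg_distrib, Finset.sum_neg_distrib] at hC
    linarith

/-- **Three-chain lemma, general form.**  For ANY middle level `Y`, nonnegativity of `(X, Y, Z)` on all chains of up-sets is equivalent
to the nonnegativity of BOTH merged pairs `(X ; Y+Z)` and `(X+Y ; Z)` provided `Y` has a constant sign (it is `c·Π₁` with `Π₁ ≥ 0` in the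
application); without any sign assumption the two merged pairs are still NECESSARY. We record the necessity and the two sufficiency
statements together. [cite: KozmaNitzan2024, Question 8 (§5.5 p. 36)] -/
theorem threeChain_iff_both (X Pw Z : β → ℝ) (c : ℝ) (hPw : ∀ b, 0 ≤ Pw b) :
    (∀ UX UY UZ : Finset β, IsUpperSet (UX : Set β) → IsUpperSet (UY : Set β) → IsUpperSet (UZ : Set β) →
        UZ ⊆ UY → UY ⊆ UX → 0 ≤ ∑ b ∈ UX, X b + ∑ b ∈ UY, c * Pw b + ∑ b ∈ UZ, Z b) ↔
      ((∀ U1 U0 : Finset β, IsUpperSet (U1 : Set β) → IsUpperSet (U0 : Set β) → U0 ⊆ U1 →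
          0 ≤ ∑ b ∈ U1, X b + ∑ b ∈ U0, (c * Pw b + Z b)) ∧
        (∀ U1 U0 : Finset β, IsUpperSet (U1 : Set β) → IsUpperSet (U0 : Set β) → U0 ⊆ U1 →
          0 ≤ ∑ b ∈ U1, (X b + c * Pw b) + ∑ b ∈ U0, Z b)) := by
  constructor
  · intro h
    refine ⟨?_, ?_⟩
    · intro U1 U0 hU1 hU0 hsub
      have := h U1 U0 U0 hU1 hU0 hU0 (subset_refl U0) hsub
      rw [Finset.sum_add_distrib]; linarith
    · intro U1 U0 hU1 hU0 hsub
      have := h U1 U1 U0 hU1 hU1 hU0 hsub (subset_refl U1)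
      rw [Finset.sum_add_distrib]; linarith
  · rintro ⟨hlow, hhigh⟩
    rcases le_or_gt 0 c with hc | hc
    · exact (threeChain_iff_mergeLow_of_nonneg X (fun b => c * Pw b) Z
        (fun b => mul_nonneg hc (hPw b))).2 hlow
    · exact (threeChain_iff_mergeHigh_of_nonpos X (fun b => c * Pw b) Z
        (fun b => mul_nonpos_iff.2 (Or.inr ⟨hc.le, hPw b⟩))).2 hhigh

end PocketCert

end Summit.CriticalPhenomena.PercolationContinuityZ3.Theorems
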